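import Summits.BirchSwinnertonDyer.BirchSwinnertonDyer.Theorems.AlignedTransportAtTwoMainConjectureOfRankZeroBSDAtTwoCMSexticCurrency
import Literature.NumberTheory.EllipticCurves.TwoAdicImageQuadraticTwistProofs
import HarnessLib

/-!
# Route `AlignedTransportAtTwo`, crux C2 `MainConjectureOfRankZeroBSDAtTwo` (stmt-BirchSwinnertonDyer-22298):
# EVERY CUBIC NUMBER FIELD IS A `2`-TORSION FIELD — the curve `y² = x³ + (A/4)x² + (B/16)x + C/64` has `u`-cubic `u³ + Au² + Bu + C`;
# hence the cell's `W`-parametrised field theory applies to ARBITRARY cubic fields, e.g. (W-free):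
# for a COMPLEX cubic field `F`, `μ₂ = 0` for `F(√−1)^cyc` ⟺ `μ₂ = 0` for `F^cyc`

HONEST FRAMING. WIDTH-5 attached prover seat `bsd-line-att-p4` g32 on line `birth`; `--supports` stmt-BirchSwinnertonDyer-22298, closes nothing; BSD is NOT
proved; crux C2, its verdict and every registered stub untouched. THEOREMS ONLY (no `def`, no named fact, no `sorry`). Sequel of `…CMSexticCurrency` /
`…CMSexticFieldDoor` (this seat): there C2 was reduced BY NAME to ONE hypothesis «`μ₂ = 0` along the cyclotomic `ℤ₂`-extension of `F(√−1)` for every cubic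
number field `F`», and the tree knows (att-p3 g34, `W`-parametrised) that on the `Δ_W < 0` half `μ₂(ℚ(β,i)) = 0 ⟺ μ₂(ℚ(β)) = 0`. This file removes `W`:

* §1 THE UNIVERSAL `u`-CUBIC. For rationals `A, B, C` let `W_{A,B,C} : y² = x³ + (A/4)x² + (B/16)x + (C/64)` (written as a structure literal; no definition):
  `b₂ = A`, `b₄ = B/8`, `b₆ = C/16`, `twoDivisionUCubic W_{A,B,C} = X³ + AX² + BX + C` (`twoDivisionUCubic_universal`), `Δ(W_{A,B,C}) = disc(X³+AX²+BX+C)/256`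
  (`Δ_universal`), and «`x³ + Ax² + Bx + C` has no rational root» ⟹ `W_{A,B,C}` has no rational `2`-torsion abscissa. So EVERY cubic number field `F = ℚ(e)`,
  `e³ + Ae² + Be + C = 0`, is the cubic `2`-torsion field of an elliptic curve over `ℚ` with `E(ℚ)[2] = 0`, complex cubics giving `Δ < 0`, totally real
  ones `Δ > 0`; all of the cell's `W`-parametrised Iwasawa-theoretic field lemmas (att-p3/att-p4/att-p5 lineages) become statements about cubic fields.
* §2 ★★ `forall_classicalMuVanishes_quadratic_iff_of_cubic_of_disc_neg` — **W-FREE: for a cubic number field `F ∋ e`, `e³ + Ae² + Be + C = 0` with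
  `x³ + Ax² + Bx + C` without rational root, NEGATIVE discriminant `D = A²B² − 4B³ − 4A³C − 27C² + 18ABC` (a complex cubic field) and `−2D ∉ ℚ²`, and a
  quadratic extension `F′/F` containing a square root of `−1`: `μ₂ = 0` (growth form) for every cyclotomic `ℤ₂`-extension of `F′` ⟺ the same for `F`.**
  (att-p3 g34's `classicalMuVanishes_pointFieldCM_iff_cubic_of_Δ_neg` on `W_{A,B,C}`, transported to `F′` by `…CMSexticCurrency` and to `F` by g31's
  `forall_classicalMuVanishes_iff_adjoin_xT_of_root`.) So the single hypothesis of `…CMSexticFieldDoor.crux_of_forall_cubicField_adjoin_sqrt_neg_one_classicalMu`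
  restricted to complex cubic fields IS Iwasawa's `μ₂`-conjecture for complex cubic fields (g31's H3M currency); only on totally real cubics does `√−1` add content
  (Kida 1982 Thm. 1: there it is the NARROW `μ₂⁺(F) = 0`).

References: [SilvermanAEC2009] III.§1 (`b₂, b₄, b₆`, `Δ`, the `2`-division polynomial); [Iwasawa1973MuInvariants] Thm. 2/3, §3; [Kida1982JFields] Thm. 1 and
Remark (ii); [Washington1997] §13.1; tree: this seat `…CMSexticCurrency`, g31 `…SharedCubicDivisionField`, att-p3 g34 `…PointFieldCarrierCMIff`,
`Literature/…/TwoAdicImageQuadraticTwistProofs` (`hasRationalTwoTorsionX_iff_twoDivision`).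
-/

-- the Theorems namespace of this sub repeats the summit name by design (D-0017 nested layout)
set_option linter.dupNamespace false
set_option autoImplicit false

noncomputable section

open scoped Classical NumberField IntermediateField

namespace Summit.BirchSwinnertonDyer.BirchSwinnertonDyer.Theorems.AlignedTransportAtTwoCubicFieldsAsTwoTorsionFields

open NumberField Polynomial WeierstrassCurve IntermediateField Field
  Literature.NumberTheory.EllipticCurves Literature.NumberTheory.EllipticCurves.Greenberg1999
  Literature.NumberTheory.EllipticCurves.DokchitserDokchitser2012
  Literature.NumberTheory.EllipticCurves.ZpExtension Literature.NumberTheory.GaloisRepresentations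
  Literature.NumberTheory.IwasawaTheory Literature.NumberTheory.NumberFields
  Summit.BirchSwinnertonDyer.Rank1Residual.F1Sign2
  Summit.BirchSwinnertonDyer.BirchSwinnertonDyer.Theorems.AlignedTransportAtTwoFineRoad.DivisionCubic
  Summit.BirchSwinnertonDyer.BirchSwinnertonDyer.Theorems.AlignedTransportAtTwoPointFieldCarrierCMIff
  Summit.BirchSwinnertonDyer.BirchSwinnertonDyer.Theorems.AlignedTransportAtTwoSharedCubicDivisionField
  Summit.BirchSwinnertonDyer.BirchSwinnertonDyer.Theorems.AlignedTransportAtTwoCMSexticCurrency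

/-! ## §1 The universal `u`-cubic: `W_{A,B,C} : y² = x³ + (A/4)x² + (B/16)x + C/64` -/

section Universal

variable (A B C : ℚ)

/-- `b₂(W_{A,B,C}) = A`. [cite: SilvermanAEC2009, III.§1] -/
theorem b₂_universal : (⟨0, A / 4, 0, B / 16, C / 64⟩ : WeierstrassCurve ℚ).b₂ = A := by
  simp only [WeierstrassCurve.b₂]; ring

/-- `b₄(W_{A,B,C}) = B/8`. [cite: SilvermanAEC2009, III.§1] -/
theorem b₄_universal : (⟨0, A / 4, 0, B / 16, C / 64⟩ : WeierstrassCurve ℚ).b₄ = B / 8 := by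
  simp only [WeierstrassCurve.b₄]; ring

/-- `b₆(W_{A,B,C}) = C/16`. [cite: SilvermanAEC2009, III.§1] -/
theorem b₆_universal : (⟨0, A / 4, 0, B / 16, C / 64⟩ : WeierstrassCurve ℚ).b₆ = C / 16 := by
  simp only [WeierstrassCurve.b₆]; ring

/-- ★ **THE UNIVERSAL `u`-CUBIC: `twoDivisionUCubic W_{A,B,C} = X³ + AX² + BX + C`** — every monic cubic over `ℚ` is the `u`-cubic
`u³ + b₂u² + 8b₄u + 16b₆` of a Weierstrass curve over `ℚ`. [cite: SilvermanAEC2009, III.§1] -/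
theorem twoDivisionUCubic_universal :
    twoDivisionUCubic (⟨0, A / 4, 0, B / 16, C / 64⟩ : WeierstrassCurve ℚ) =
      X ^ 3 + Polynomial.C A * X ^ 2 + Polynomial.C B * X + Polynomial.C C := by
  rw [twoDivisionUCubic, b₂_universal, b₄_universal, b₆_universal]
  congr 2 <;> [congr 2; skip] <;> congr 1 <;> [congr 1; skip] <;> ring_nf

/-- **`Δ(W_{A,B,C}) = disc(X³ + AX² + BX + C)/256`**, `disc = A²B² − 4B³ − 4A³C − 27C² + 18ABC`. [cite: SilvermanAEC2009, III.§1] -/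
theorem Δ_universal :
    (⟨0, A / 4, 0, B / 16, C / 64⟩ : WeierstrassCurve ℚ).Δ =
      (A ^ 2 * B ^ 2 - 4 * B ^ 3 - 4 * A ^ 3 * C - 27 * C ^ 2 + 18 * A * B * C) / 256 := by
  simp only [WeierstrassCurve.Δ, WeierstrassCurve.b₂, WeierstrassCurve.b₄, WeierstrassCurve.b₆, WeierstrassCurve.b₈]
  ring

/-- `W_{A,B,C}` is an elliptic curve as soon as `disc(X³ + AX² + BX + C) ≠ 0`. [cite: SilvermanAEC2009, III.§1 Prop. 1.4] -/
theorem isElliptic_universal (hD : A ^ 2 * B ^ 2 - 4 * B ^ 3 - 4 * A ^ 3 * C - 27 * C ^ 2 + 18 * A * B * C ≠ 0) :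
    (⟨0, A / 4, 0, B / 16, C / 64⟩ : WeierstrassCurve ℚ).IsElliptic :=
  ⟨by rw [Δ_universal]; exact isUnit_iff_ne_zero.mpr (div_ne_zero hD (by norm_num))⟩

/-- **No rational root of `x³ + Ax² + Bx + C` ⟹ no rational `2`-torsion abscissa on `W_{A,B,C}`** (a rational `2`-torsion abscissa `x` gives the root `4x`).
[cite: SilvermanAEC2009, III.§1 and III.2.3] -/
theorem not_hasRationalTwoTorsionX_universal (hirr : ∀ x : ℚ, x ^ 3 + A * x ^ 2 + B * x + C ≠ 0) :
    ∀ x : ℚ, ¬ HasRationalTwoTorsionX (⟨0, A / 4, 0, B / 16, C / 64⟩ : WeierstrassCurve ℚ) x := by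
  intro x hx
  rw [hasRationalTwoTorsionX_iff_twoDivision, b₂_universal, b₄_universal, b₆_universal] at hx
  exact hirr (4 * x) (by linear_combination (16 : ℚ) * hx)

/-- **Every root `e` of `x³ + Ax² + Bx + C` (in any `ℚ`-algebra that is a field) is a root of the `u`-cubic of `W_{A,B,C}`.** [cite: SilvermanAEC2009, III.§1] -/
theorem aeval_twoDivisionUCubic_universal_eq_zero {F : Type} [Field F] [Algebra ℚ F] {e : F}
    (he : e ^ 3 + algebraMap ℚ F A * e ^ 2 + algebraMap ℚ F B * e + algebraMap ℚ F C = 0) :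
    aeval e (twoDivisionUCubic (⟨0, A / 4, 0, B / 16, C / 64⟩ : WeierstrassCurve ℚ)) = 0 := by
  rw [twoDivisionUCubic_universal]
  simp only [map_add, map_mul, map_pow, aeval_X, aeval_C]
  exact he

/-- `Δ(W_{A,B,C}) < 0` iff the discriminant of the cubic is negative (complex cubic fields). [cite: SilvermanAEC2009, III.§1] -/
theorem Δ_universal_neg_iff :
    (⟨0, A / 4, 0, B / 16, C / 64⟩ : WeierstrassCurve ℚ).Δ < 0 ↔
      A ^ 2 * B ^ 2 - 4 * B ^ 3 - 4 * A ^ 3 * C - 27 * C ^ 2 + 18 * A * B * C < 0 := by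
  rw [Δ_universal, div_neg_iff]
  constructor
  · rintro (⟨_, h⟩ | ⟨h, _⟩)
    · norm_num at h
    · exact h
  · exact fun h ↦ Or.inr ⟨h, by norm_num⟩

/-- `−2Δ(W_{A,B,C}) ∈ ℚ²` iff `−2·disc ∈ ℚ²` (they differ by the square factor `256 = 16²`). [folklore] -/
theorem isSquare_neg_two_mul_Δ_universal_iff :
    IsSquare (-2 * (⟨0, A / 4, 0, B / 16, C / 64⟩ : WeierstrassCurve ℚ).Δ) ↔
      IsSquare (-2 * (A ^ 2 * B ^ 2 - 4 * B ^ 3 - 4 * A ^ 3 * C - 27 * C ^ 2 + 18 * A * B * C)) := by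
  rw [Δ_universal]
  constructor
  · rintro ⟨r, hr⟩
    exact ⟨16 * r, by linear_combination (256 : ℚ) * hr⟩
  · rintro ⟨r, hr⟩
    exact ⟨r / 16, by linear_combination hr / 256⟩

end Universal

/-! ## §2 W-free: on a COMPLEX cubic field, `μ₂(F(√−1)) = 0 ⟺ μ₂(F) = 0` -/

section Complex

/-- ★★ **W-FREE, complex cubic fields: `μ₂ = 0` for `F(√−1)^cyc` ⟺ `μ₂ = 0` for `F^cyc`.** `F` a cubic number field containing `e` with `e³ + Ae² + Be + C = 0`,
where `x³ + Ax² + Bx + C` has no rational root, NEGATIVE discriminant `D = A²B² − 4B³ − 4A³C − 27C² + 18ABC` (so `F` is a complex cubic field) and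
`−2D ∉ ℚ²`; `F′/F` quadratic containing `i` with `i² = −1`. Then «`μ = 0` (growth form) for every cyclotomic `ℤ₂`-extension of `F′`» ⟺ «the same for `F`».
Proof: `F = ℚ(β)` and `F′ = ℚ(β, √−1)` up to `ℚ`-isomorphism for a root `β` of the `2`-division cubic of the elliptic curve `W_{A,B,C}` (§1, `Δ < 0`,
`E(ℚ)[2] = 0`); att-p3 g34's `μ₂(ℚ(β,i)) = 0 ⟺ μ₂(ℚ(β)) = 0` on `Δ < 0` (through the totally imaginary `S₃`-closure); transports of `…CMSexticCurrency` and g31.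
On complex cubics the hypothesis «`μ₂(F(√−1)) = 0`» of this seat's crux-by-name theorem is therefore exactly Iwasawa's `μ₂ = 0` for `F` itself.
[cite: Iwasawa1973MuInvariants, Thm. 2 and Thm. 3, §3] [cite: Washington1997, §13.1 and Prop. 4.11] [cite: Kida1982JFields, Thm. 1 and Remark (ii)] -/
theorem forall_classicalMuVanishes_quadratic_iff_of_cubic_of_disc_neg
    (F F' : Type) [Field F] [NumberField F] [Field F'] [NumberField F'] [Algebra F F']
    (hF : Module.finrank ℚ F = 3) (hFF' : Module.finrank F F' = 2) {i : F'} (hi : i ^ 2 = -1)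
    {A B C : ℚ} {e : F} (he : e ^ 3 + algebraMap ℚ F A * e ^ 2 + algebraMap ℚ F B * e + algebraMap ℚ F C = 0)
    (hirr : ∀ x : ℚ, x ^ 3 + A * x ^ 2 + B * x + C ≠ 0)
    (hD : A ^ 2 * B ^ 2 - 4 * B ^ 3 - 4 * A ^ 3 * C - 27 * C ^ 2 + 18 * A * B * C < 0)
    (hm2D : ¬ IsSquare (-2 * (A ^ 2 * B ^ 2 - 4 * B ^ 3 - 4 * A ^ 3 * C - 27 * C ^ 2 + 18 * A * B * C))) :
    (∀ κ' : ZpExtension F' 2, κ'.IsCyclotomic → ClassicalMuVanishes κ') ↔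
      ∀ κ : ZpExtension F 2, κ.IsCyclotomic → ClassicalMuVanishes κ := by
  set W : WeierstrassCurve ℚ := ⟨0, A / 4, 0, B / 16, C / 64⟩ with hW
  haveI : W.IsElliptic := isElliptic_universal A B C hD.ne
  have ht : ∀ x : ℚ, ¬ HasRationalTwoTorsionX W x := not_hasRationalTwoTorsionX_universal A B C hirr
  have hΔ : W.Δ < 0 := (Δ_universal_neg_iff A B C).mpr hD
  have hm2Δ : ¬ IsSquare (-2 * W.Δ) := fun h ↦ hm2D ((isSquare_neg_two_mul_Δ_universal_iff A B C).mp h)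
  have heW : aeval e (twoDivisionUCubic W) = 0 := aeval_twoDivisionUCubic_universal_eq_zero A B C he
  obtain ⟨i₀, hi₀⟩ : ∃ i₀ : AlgebraicClosure ℚ, i₀ ^ 2 = -1 := IsAlgClosed.exists_pow_nat_eq (-1) two_pos
  rw [forall_classicalMuVanishes_iff_pointFieldCM W ht (finrank_eq_six_of_quadratic_over_cubic hF hFF')
      (aeval_algebraMap_twoDivisionUCubic W heW) hi 0 hi₀,
    classicalMuVanishes_pointFieldCM_iff_cubic_of_Δ_neg W ht hΔ hm2Δ hi₀ 0,
    forall_classicalMuVanishes_iff_adjoin_xT_of_root W ht hF heW 0]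

/-- **The same with `F′` presented intrinsically** (`[F′:ℚ] = 6`, `e, i ∈ F′`, `e³ + Ae² + Be + C = 0`, `i² = −1`) against ANY cubic number field `F₀ ∋ e₀` with
`e₀³ + Ae₀² + Be₀ + C = 0`: complex cubic (`D < 0`, `−2D ∉ ℚ²`, no rational root) ⟹ («`μ₂ = 0` for `F′`» ⟺ «`μ₂ = 0` for `F₀`»).
[cite: Iwasawa1973MuInvariants, Thm. 2 and Thm. 3, §3] [cite: Washington1997, §13.1] -/
theorem forall_classicalMuVanishes_sextic_iff_cubic_of_disc_neg
    (F₀ : Type) [Field F₀] [NumberField F₀] (hF₀ : Module.finrank ℚ F₀ = 3)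
    (F' : Type) [Field F'] [NumberField F'] (hF' : Module.finrank ℚ F' = 6) {i : F'} (hi : i ^ 2 = -1)
    {A B C : ℚ} {e₀ : F₀} (he₀ : e₀ ^ 3 + algebraMap ℚ F₀ A * e₀ ^ 2 + algebraMap ℚ F₀ B * e₀ + algebraMap ℚ F₀ C = 0)
    {e : F'} (he : e ^ 3 + algebraMap ℚ F' A * e ^ 2 + algebraMap ℚ F' B * e + algebraMap ℚ F' C = 0)
    (hirr : ∀ x : ℚ, x ^ 3 + A * x ^ 2 + B * x + C ≠ 0)
    (hD : A ^ 2 * B ^ 2 - 4 * B ^ 3 - 4 * A ^ 3 * C - 27 * C ^ 2 + 18 * A * B * C < 0)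
    (hm2D : ¬ IsSquare (-2 * (A ^ 2 * B ^ 2 - 4 * B ^ 3 - 4 * A ^ 3 * C - 27 * C ^ 2 + 18 * A * B * C))) :
    (∀ κ' : ZpExtension F' 2, κ'.IsCyclotomic → ClassicalMuVanishes κ') ↔
      ∀ κ : ZpExtension F₀ 2, κ.IsCyclotomic → ClassicalMuVanishes κ := by
  set W : WeierstrassCurve ℚ := ⟨0, A / 4, 0, B / 16, C / 64⟩ with hW
  haveI : W.IsElliptic := isElliptic_universal A B C hD.ne
  have ht : ∀ x : ℚ, ¬ HasRationalTwoTorsionX W x := not_hasRationalTwoTorsionX_universal A B C hirr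
  have hΔ : W.Δ < 0 := (Δ_universal_neg_iff A B C).mpr hD
  have hm2Δ : ¬ IsSquare (-2 * W.Δ) := fun h ↦ hm2D ((isSquare_neg_two_mul_Δ_universal_iff A B C).mp h)
  obtain ⟨i₀, hi₀⟩ : ∃ i₀ : AlgebraicClosure ℚ, i₀ ^ 2 = -1 := IsAlgClosed.exists_pow_nat_eq (-1) two_pos
  rw [forall_classicalMuVanishes_iff_pointFieldCM W ht hF' (aeval_twoDivisionUCubic_universal_eq_zero A B C he) hi 0 hi₀,
    classicalMuVanishes_pointFieldCM_iff_cubic_of_Δ_neg W ht hΔ hm2Δ hi₀ 0,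
    forall_classicalMuVanishes_iff_adjoin_xT_of_root W ht hF₀ (aeval_twoDivisionUCubic_universal_eq_zero A B C he₀) 0]

end Complex

end Summit.BirchSwinnertonDyer.BirchSwinnertonDyer.Theorems.AlignedTransportAtTwoCubicFieldsAsTwoTorsionFields

end
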